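import Literature.MathematicalPhysics.QuantumFieldTheory.Balaban1983to89.B9Eq3126H1kPiSliceGradRowClosed

/-!
# `Balaban1983to89.B9Eq3147MiddleWordPiSliceGradRowClosed` — T. Bałaban, *Propagators for lattice gauge theories in a background field*, Commun. Math. Phys. **99**
# (1985) 389–434 [Balaban1985BackgroundPropagators] (3.147) p. 425 (*«𝔓 = I − G₁Q\*(QG₁Q\*)⁻¹Q − G₁DRD\*»*), (3.153) p. 426 (*«G₁𝔓\* is equal to the operator 𝔊»*),
# (3.126) p. 420, (3.3) p. 391, Thm 3.3 p. 399 (the GRADIENT member of (3.42)), Thm 3.13 p. 426; [Balaban1985Variational] (110)–(111) p. 294 (*«𝔊 = G − GQ\*(QGQ\*)⁻¹QG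
# − GDRD\*G»*), (115) p. 294, (117) p. 295: **THE SLICE-GRADIENT ROW OF THE MIDDLE WORD `H̃_kQ_kG̃_k` OF PRINT's `𝔊̃_k = G̃_k − H̃_kQ_kG̃_k − G̃_kD_UR_kD*_UG̃_k`
# ON THE CELL's MODEL, ∃-FIRST, HEIGHT-FREE** — ne9-leaf-05 g87's `B9Eq3147MiddleWordSliceGradRowClosed` (the middle word `H₁,kQ_kG₁,k` of `𝔓_kG₁,k`) RE-RUN AT
# PRINT's `G̃_k = Δ̃_{a,k}⁻¹`, i.e. (K82) `B9Eq3147MiddleWordPiSupRowClosed`'s two (K61) `letter_comp` with the OUTER factor `∇_μ∘H̃_k` read from (J-1)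
# `B9Eq3126H1kPiSliceGradRowClosed.exists_local_gradLetter_H1LatticeKPi`: (L)(G̃_k) = (K77) `exists_local_letters_G1LatticeKPi` `.1` (fine bonds → fine bonds) ∘
# THE `Q_k` LETTER (range `1`, size `2√d·C_Q(α₁)e^{κ}`, HEIGHT-FREE — (K82)'s station byte for byte) ∘ (J-1) (coarse bonds → fine bonds, `∇_μ` post-composed)

statement-level skeleton of published theorems with citation tags; proofs where landed; nothing here is a claim about the Yang–Mills mass gap

CITATION HEADER (lean-in-tree rule).  Audit cell `pub-balaban`, sub-cell `t4`, BINDER row NE9; NE9 crux-team LEAF PROVER 01 (`b2b-balaban-t4-ne9-formalise-leaf-01`, gen 91;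
(J-2); bears_on: R4/N22).  The GRADIENT half of the NE9 owner's RULING R-ne9p1-g97-4 (2)(b) (journal `HOME/CLAIMS.log` l.66556; memo
`t4/b2b-balaban-t4-ne9-p1/g97/PLAN-V16-SEED.md` §2 (b), §6 (V-loc) «the GRADIENT conjunct»).  Composed BY NAME, nothing restated: (K61) `letter_comp`, (K63)
`B9Eq3126H1SupRowOfLetters.letter_of_range`, (K77) (ne9-leaf-05 g88), (J-1), ne9-leaf-03's `B9Eq315QkLocalLetter.QkOfU_apply_eq_zero_of_support` ∕ (PSK-tower)
`B9Eq316PenaltyStencilLetterTower.norm_equiv_QkW_apply_le_blocks` ∕ (SBLT) `B9Eq315QkSingleBondLetter.equiv_QkW_apply` ∕ `B9Eq347LocalFromBlockDecay.norm_le_sqrt_mass_mul` ∕ (ECL)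
`B9Eq326LocalPartTowerSupDecayDiagonalClosed.sum_bondMass_bigBlock_le`, this lineage's `B9Eq349BlockMultipliers.exists_block_clm_family` ∕ `B9Eq349BlockDistanceWeight.tdist_shift_le_one`,
`B4Sect5Torus.torusSum_le`, the owner's (VGT-a) `B9Eq326LocalPartTowerSliceGradientRow.norm_covGrad_apply_le_of_slice` and (E2)'s slice device (an `⟨_, rfl⟩` continuous linear map —
no definition).  Sources read through the audited headers of (K82), (J-1)'s parents (`paper:balaban1985-cmp99-background-propagators`, journal page = PDF page + 388: p. 391 (3.3),
p. 397 (3.42), p. 399 Thm 3.3, p. 420 (3.126), p. 425 (3.147), p. 426 (3.153), Thm 3.13).  NOTHING of print's proof is reproduced; no constant of print is valued.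

WHAT IS PROVED (sorry-free; proof lane — no `def`; [folklore] composition BY NAME).
* **`exists_local_gradLetter_H1kPiQkG1kPi`** — `∃ α₁ j₁ B δ` (`0 < α₁`, `0 < j₁`, `0 ≤ B`, `0 < δ`) BEFORE (K82)'s binder block VERBATIM, then `(μ : Fin d) (b)`: for every
  fine-bond field `f` supported over the big block `Π⁻¹(v)` with `‖f(b′)‖ ≤ F`, every component `μ` and fine bond `b`:
  `‖(D_U(H̃_kQ_kG̃_kf)_μ)(b)‖ ≤ B·e^{−δ·d_m(Π(b₋), v)}·F` and `‖(∇_U(H̃_kQ_kG̃_kf))(b, μ)‖ ≤ B·e^{−δ·d_m(Π(b₋), v)}·F`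
  (`H̃_kQ_kG̃_kf = H1LatticeK hposπ hQ (QkW (G1LatticeK hposπ f))`).  Rates: `κ := min(δ_T, δ_H′)` ((K77)'s and (J-1)'s), the `Q_k` letter at rate `κ` (price `e^{κ}`),
  the rate lost ONCE (`δ := κ∕2`); radii `α₁ := min(α_T, α_H′)`, `j₁ := min(j_T, j_H′)`; `B = B_T·(2√d·C_Q(α₁)·e^{κ})·K·B_H′·K`, `K = K_d(κ∕2)`.
HONEST SCOPE.  The gradient companion of (K82) (value row); with (K82), (K77), (T4B) the first TWO words of `𝔊̃_k` have value AND gradient letters; the third word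
`G̃_kD_UR_kD*_UG̃_k` has its value letter ((T4E)) — its gradient letter is STOREY H (R-ne9p1-g97-3), NOT here.  A theorem about the cell's MODEL; `hpos′`, `hpos`, `hposπ`,
`hQ`, the windows, the level data, `c₀ = η^d`, `‖J‖ ≤ j₀` stay HYPOTHESES; constants crude and symbolic; nothing of [B9] Thm 3.1 ∕ 3.3 ∕ 3.11 ∕ 3.13 or [B11] (117) asserted,
valued or discharged; «NE9 ⇐ the named binders»; NE9 NOT PRINTED ∕ NOT PROVED; row WALLED ON A MODEL (O-NE9-1; #5 UNRULED); spine PROVED 0∕9; rung (B)+1 on a finite T⁴ —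
NOT infinite volume, NOT mass gap, NOT BetaPertH, NOT Clay.  HONEST DEPENDENCY: continuum YM on T⁴ ⇐ BetaPertH ∧ nine spine estimates (0/9 proved); BetaPertH ⇐ (D1) ∧ (D4) ∧
CAP+tail; G-an2-4 gates asym, D1 and NE2/3/4.  NEW file behind (J-1); nothing modified.  Net new unproved facts: 0.
-/

noncomputable section

set_option autoImplicit false

open scoped InnerProductSpace ComplexConjugate BigOperators

namespace Literature.MathematicalPhysics.QuantumFieldTheory.Balaban1983to89.B9Eq3147MiddleWordPiSliceGradRowClosed



open B4Sect5Torus (TSite tdist tdist_nonneg tdist_symm tdist_self tdist_triangle torusSum_le)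
open B4Sect5Proof (latticeConst latticeConst_nonneg)
open B9SectCLatticeCarrier (Bond DirPair bpos btgt shift unshift)
open B9Eq311L2Pairing (WL2)
open B9Eq319QprimeTorus (fineP blockCoord)
open B7Prop1Explicit (U1 Wcx boxVec)
open B11Eq103H1Complex (SiteL2K BondL2K greenK covDerivL2K covDivL2K G1LatticeK KinvLatticeK H1LatticeK)
open B9Eq33CovDerivVector (covGrad)
open B9Eq310DeltaPrime (plaqHolU)
open B9Eq310HessianOperator (adTransportW hessOp)
open B9Eq310HessianHermitian (adTransportW_adjoint)
open B9Eq315QTorus (perCfg cornerSite)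
open B9Eq315QTower (towerP UlevOf)
open B9Eq316TowerFlatIsOneStep (towerP_eq_fineP_pow siteCast)
open B9Eq326OperatorTower (QprimeTowerW QkW RofUk laplaceAk G1k)
open B9Eq324DeltaPrimeATower (laplacePrimeAk GpOfUk)
open B9Eq33CovDerivLocalLetterTower (tdist_bigBlock_bpos_btgt_le_one)
open B9Eq3117GaugeModeStencilLettersTower (local_hessOp_covDerivL2K_tower local_covDivL2K_hessOp_tower)
open B9Eq3130GtildePairRowsClosedTower (exists_local_letters_G1LatticeKPi)
open B9Eq3126H1kPiSliceGradRowClosed (exists_local_gradLetter_H1LatticeKPi)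
open B9Eq326LocalPartTowerSliceGradientRow (norm_covGrad_apply_le_of_slice)
open B9Eq3119DeltaPiTower (piOfUk laplaceAkPi)

variable {d : ℕ} (hd : 1 ≤ d) (L : ℕ) [NeZero L] (hL : 1 ≤ L) (hL3 : 3 ≤ L)
  {𝔸 : Type*} [NormedRing 𝔸] [NormedAlgebra ℂ 𝔸] [CompleteSpace 𝔸] [NormOneClass 𝔸] [StarRing 𝔸] [NormedStarGroup 𝔸] [StarModule ℂ 𝔸]
  {W : Type*} [NormedAddCommGroup W] [InnerProductSpace ℂ W] [FiniteDimensional ℂ W] (φ : W ≃ₗ[ℂ] 𝔸)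
  {Mφ Mφ' : ℝ} (hMφ : 0 ≤ Mφ) (hMφ' : 0 ≤ Mφ') (hφ : ∀ w, ‖φ w‖ ≤ Mφ * ‖w‖) (hφ' : ∀ X, ‖φ.symm X‖ ≤ Mφ' * ‖X‖) (hstar : ∀ X : 𝔸, ‖star X‖ ≤ ‖X‖)
  {a : ℝ} (ha : 0 < a) {a' : ℝ} (ha' : 0 < a') {ϱ : ℝ} (hϱ0 : 0 ≤ ϱ) (hϱ1 : ϱ < 1)
  (τ : 𝔸 →ₗ[ℂ] ℂ) {Cτ : ℝ} (hτ : ∀ X, ‖τ X‖ ≤ Cτ * ‖X‖) (hCτ : 0 ≤ Cτ) {Mτ : ℝ} (hτm : ∀ X Y : 𝔸, ‖τ (X * Y)‖ ≤ Mτ * ‖X‖ * ‖Y‖) (hMτ : 0 ≤ Mτ)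
  {ρw : ℝ} (hρw : 0 ≤ ρw)
  (hτ₁ : ∀ X : 𝔸, τ (star X) = conj (τ X)) (hτ₂ : ∀ X Y : 𝔸, τ (X * Y) = τ (Y * X)) (hφτ : ∀ X Y : 𝔸, ⟪φ.symm X, φ.symm Y⟫_ℂ = τ (star X * Y))
  (AQ : ℝ)

open B9Eq326G1SupRowOfLetters (letter_comp letter_mono)
open B9Eq3126H1SupRowOfLetters (letter_of_range)
open B9Eq349BlockMultipliers (exists_block_clm_family)
open B9Eq349BlockDistanceWeight (tdist_shift_le_one)
open B9Eq315QkLocalLetter (QkOfU_apply_eq_zero_of_support)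
open B9Eq315QkSingleBondLetter (equiv_QkW_apply)
open B9Eq316PenaltyStencilLetterTower (norm_equiv_QkW_apply_le_blocks)
open B9Eq347LocalFromBlockDecay (norm_le_sqrt_mass_mul)
open B9Eq326LocalPartTowerSupDecayDiagonalClosed (sum_bondMass_bigBlock_le)

omit [NeZero L] in
/-- `e^{−r t} ≤ e^{−κ t}` for `κ ≤ r`, `0 ≤ t`. [folklore] -/
private theorem exp_weaken' {r κ t : ℝ} (hκ : κ ≤ r) (ht : 0 ≤ t) : Real.exp (-(r * t)) ≤ Real.exp (-(κ * t)) :=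
  Real.exp_le_exp.2 (by nlinarith)

set_option maxHeartbeats 400000 in -- margin only, as (K82): the ≈ 50-binder supplier block read twice
include hd hL hL3 hMφ hMφ' hφ hφ' hstar ha ha' hϱ0 hϱ1 hτ hCτ hτm hMτ hρw hτ₁ hτ₂ hφτ in
/-- **THE SLICE-GRADIENT ROW OF THE MIDDLE WORD `H̃_kQ_kG̃_k` OF `𝔊̃_k` ON THE CELL's MODEL, ∃-FIRST** — two (K61) `letter_comp` of (L)(G̃_k; B_T, κ)
((K77) `.1`), (L)(Q_k; C_Q·2√d·e^κ, κ) ((K66)∕(K82)'s station: `norm_equiv_QkW_apply_le_blocks` through the window, range `1`, `letter_of_range`),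
(L)(∇_μ∘H̃_k; B_H′, κ) ((J-1) `exists_local_gradLetter_H1LatticeKPi` member 1, output `Π∘bpos`) with the outer factor `Dcl ∘L Hcl` ((E2)'s slice device
post-composed with `H̃_k = H1LatticeK hposπ hQ`); `κ = min` of the two rates, one rate loss (`δ = κ∕2`); the `∇_U` member by `norm_covGrad_apply_le_of_slice`.
[cite: Balaban1985BackgroundPropagators, (3.147) p.425, (3.153) p.426, (3.126) p.420, (3.3) p.391, Thm 3.3 p.399, Thm 3.13 p.426]
[cite: Balaban1985Variational, (110)–(111) p.294, (117) p.295] -/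
theorem exists_local_gradLetter_H1kPiQkG1kPi :
    ∃ α₁ j₁ B δ : ℝ, 0 < α₁ ∧ 0 < j₁ ∧ 0 ≤ B ∧ 0 < δ ∧
      ∀ (n : ℕ) (η : ℝ) (_hηL : η * (L : ℝ) ^ (n + 1) = 1) (c₀ c₁ : ℝ) [Fact (0 < c₀)] [Fact (0 < c₁)]
        (_hw : c₀ * ((L : ℝ) ^ (n + 1)) ^ d = c₁) (_hρ : |η| ^ d / c₀ ≤ ρw) (m : Fin d → ℕ) [∀ i, NeZero (m i)] (_hm : ∀ i, 1 ≤ m i)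
        (U : Bond d (towerP L m (n + 1)) → 𝔸ˣ) (αU : ℕ → ℝ) (_hα0 : ∀ j, 0 ≤ αU j) (hα1 : ∀ j, αU j ≤ 1 / 64)
        (hαL : ∀ j, 50 * (d + 1) * αU j * (L : ℝ) ^ d ≤ 1 / 2)
        (hU1 : ∀ (j : ℕ) (x : B7Prop1Explicit.Site d) (k : Fin d), perCfg (towerP L m (j + 1)) (UlevOf L m (n + 1) U j) x k ∈ U1 𝔸)
        (hreg : ∀ (j : ℕ) (y : TSite d (towerP L m j)) (k : Fin d) (ρ' : Fin d → Fin L),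
          ‖((Wcx L (perCfg (towerP L m (j + 1)) (UlevOf L m (n + 1) U j)) (cornerSite L y) k (boxVec L ρ') : 𝔸ˣ) : 𝔸) - 1‖ ≤ αU j)
        (εU : ℕ → ℝ) (_hεU : ∀ j, 0 ≤ εU j) (_hUε : ∀ (j : ℕ) (b : Bond d (towerP L m (j + 1))), ‖(UlevOf L m (n + 1) U j b : 𝔸) - 1‖ ≤ εU j)
        (_hLb : ∀ (j : ℕ) (b : Bond d (towerP L m (j + 1))), UlevOf L m (n + 1) U j b ∈ U1 𝔸)
        (α : ℝ) (_hα : 0 ≤ α) (_hαle : α ≤ α₁)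
        (hUst : ∀ b, star (U b : 𝔸) = (((U b)⁻¹ : 𝔸ˣ) : 𝔸)) (_hUb : ∀ b, U b ∈ U1 𝔸) (_hUη : ∀ b, ‖(U b : 𝔸) - 1‖ ≤ α * η)
        (_hpl : ∀ p : B9SectCLatticeCarrier.Plaq d (towerP L m (n + 1)), ‖(plaqHolU U p : 𝔸) - 1‖ ≤ α * η ^ 2)
        (_hUgrad : ∀ (x : TSite d (towerP L m (n + 1))) (μ : Fin d), ‖(U (x, μ) : 𝔸) - U (unshift μ x, μ)‖ ≤ α * η ^ 2)
        (_hRlev : ∀ (j : ℕ) (b : Bond d (towerP L m (j + 1))) (w : W), ‖adTransportW φ (UlevOf L m (n + 1) U j) b w‖ ≤ ‖w‖)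
        (_hεg : ∀ j < n + 1, εU j ≤ α * ϱ ^ j) (_hAQ : ∑ j ∈ Finset.range (n + 1), αU j ≤ AQ)
        (hpos' : ∀ x : SiteL2K ℂ d (towerP L m (n + 1)) c₀ W, x ≠ 0 → 0 < RCLike.re ⟪x, laplacePrimeAk L m n φ η U a' (c₁ := c₁) x⟫_ℂ)
        (hpos : ∀ x : BondL2K ℂ d (towerP L m (n + 1)) c₀ W, x ≠ 0 →
          0 < RCLike.re ⟪x, laplaceAk L m n φ η U hL αU hα1 hU1 hreg τ (c₀ := c₀) (c₁ := c₁) a x⟫_ℂ)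
        (_hc₀η : c₀ = η ^ d) (j₀ : ℝ) (_hJ : ∀ μ y, ‖B9Eq39Adjoint.J (fun μ => B9Eq33CovDerivVector.shiftEquiv μ) (fun μ y => U (y, μ)) η μ y‖ ≤ j₀) (_hj : j₀ ≤ j₁)
        (hposπ : ∀ x : BondL2K ℂ d (towerP L m (n + 1)) c₀ W, x ≠ 0 →
          0 < RCLike.re ⟪x, laplaceAkPi L m n φ τ η U a' hpos' hL αU hα1 hU1 hreg (c₁ := c₁) a x⟫_ℂ)
        (hQ : Function.Surjective (QkW L m n φ U hL αU hα1 hU1 hreg (c₀ := c₀) (c₁ := c₁)))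
        (v : TSite d m) (f : BondL2K ℂ d (towerP L m (n + 1)) c₀ W) (F : ℝ)
        (_hfv : ∀ x, blockCoord (L ^ (n + 1)) m (siteCast (towerP_eq_fineP_pow L m (n + 1)) (bpos x)) ≠ v →
          WL2.equiv ℂ (fun _ : Bond d (towerP L m (n + 1)) => c₀) W f x = 0)
        (_hfF : ∀ x, ‖WL2.equiv ℂ (fun _ : Bond d (towerP L m (n + 1)) => c₀) W f x‖ ≤ F) (μ : Fin d) (b : Bond d (towerP L m (n + 1))),
        ‖WL2.equiv ℂ (fun _ : Bond d (towerP L m (n + 1)) => c₀) W (covDerivL2K ℂ c₀ ((η : ℂ))⁻¹ (adTransportW φ U)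
            ((WL2.equiv ℂ (fun _ : TSite d (towerP L m (n + 1)) => c₀) W).symm fun y =>
              WL2.equiv ℂ (fun _ : Bond d (towerP L m (n + 1)) => c₀) W
                (H1LatticeK hposπ hQ (QkW L m n φ U hL αU hα1 hU1 hreg (c₀ := c₀) (c₁ := c₁) (G1LatticeK hposπ f))) (y, μ))) b‖ ≤
          B * Real.exp (-(δ * tdist m (blockCoord (L ^ (n + 1)) m (siteCast (towerP_eq_fineP_pow L m (n + 1)) (bpos b))) v)) * F ∧
        ‖covGrad ((η : ℂ))⁻¹ (adTransportW φ U)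
            (WL2.equiv ℂ (fun _ : Bond d (towerP L m (n + 1)) => c₀) W
              (H1LatticeK hposπ hQ (QkW L m n φ U hL αU hα1 hU1 hreg (c₀ := c₀) (c₁ := c₁) (G1LatticeK hposπ f)))) (b, μ)‖ ≤
          B * Real.exp (-(δ * tdist m (blockCoord (L ^ (n + 1)) m (siteCast (towerP_eq_fineP_pow L m (n + 1)) (bpos b))) v)) * F := by
  classical
  obtain ⟨αT, jT, BT, δT, hαT, hjT, hBT, hδT, HT⟩ :=
    exists_local_letters_G1LatticeKPi hd L hL hL3 φ hMφ hMφ' hφ hφ' hstar ha ha' hϱ0 hϱ1 τ hτ hCτ hτm hMτ hρw hτ₁ hτ₂ hφτ AQ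
  obtain ⟨αH, jH, BH, δH, hαH, hjH, hBH, hδH, HH⟩ :=
    exists_local_gradLetter_H1LatticeKPi hd L hL hL3 φ hMφ hMφ' hφ hφ' hstar ha ha' hϱ0 hϱ1 τ hτ hCτ hτm hMτ hρw hτ₁ hτ₂ hφτ AQ
  obtain ⟨αs, hαs⟩ : ∃ αs : ℝ, αs = min αT αH := ⟨_, rfl⟩
  have hαs0 : 0 < αs := by rw [hαs]; exact lt_min hαT hαH
  obtain ⟨κ, hκdef⟩ : ∃ κ : ℝ, κ = min δT δH := ⟨_, rfl⟩
  have hκ0 : 0 < κ := by rw [hκdef]; exact lt_min hδT hδH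
  have hκT : κ ≤ δT := by rw [hκdef]; exact min_le_left _ _
  have hκH : κ ≤ δH := by rw [hκdef]; exact min_le_right _ _
  obtain ⟨K, hKdef⟩ : ∃ K : ℝ, K = latticeConst d (κ - κ / 2) := ⟨_, rfl⟩
  have hK0 : 0 ≤ K := by rw [hKdef]; exact latticeConst_nonneg d (sub_pos.2 (half_lt_self hκ0)).le
  have h1ϱ : 0 < 1 - ϱ := by linarith only [hϱ1]
  obtain ⟨CQ, hCQ⟩ : ∃ C : ℝ, C = Mφ' * Mφ * Real.exp (Real.sqrt ((L : ℝ) ^ d) * (Real.sqrt (2 * d) * (102 * (d + 1) ^ 2 * L)) * (αs / (1 - ϱ))) := ⟨_, rfl⟩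
  have hCQ0 : 0 ≤ CQ := by rw [hCQ]; positivity
  obtain ⟨Bs, hBs⟩ : ∃ B : ℝ, B = BT * (CQ * (2 * Real.sqrt d) * Real.exp (κ * 1)) * K * BH * K := ⟨_, rfl⟩
  have hBs0 : 0 ≤ Bs := by rw [hBs]; positivity
  have hW0 : 0 ≤ Real.sqrt ((L : ℝ) ^ d) * (Real.sqrt (2 * d) * (102 * (d + 1) ^ 2 * L)) := by positivity
  refine ⟨αs, min jT jH, Bs, κ / 2, hαs0, lt_min hjT hjH, hBs0, half_pos hκ0, ?_⟩
  intro n η hηL c₀ c₁ _ _ hw hρ m _ hm U αU hα0 hα1 hαL hU1 hreg εU hεU hUε hLb α hα hαle hUst hUb hUη hpl hUgrad hRlev hεg hAQ hpos' hpos hc₀η j₀ hJ hj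
    hposπ hQ v f F hfv hfF μ b
  have hc₀ : (0 : ℝ) < c₀ := Fact.out
  have hc₁ : (0 : ℝ) < c₁ := Fact.out
  haveI : Nonempty (Bond d (towerP L m (n + 1))) := ⟨b⟩
  haveI : Nonempty (Bond d m) := ⟨(v, ⟨0, hd⟩)⟩
  have y₀ : TSite d (towerP L m (n + 1)) := b.1
  have b' : Bond d m := (v, ⟨0, hd⟩)
  have hF0 : 0 ≤ F := (norm_nonneg _).trans (hfF b)
  have hαT_ : α ≤ αT := hαle.trans (by rw [hαs]; exact min_le_left _ _)
  have hαH_ : α ≤ αH := hαle.trans (by rw [hαs]; exact min_le_right _ _)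
  have hjT_ : j₀ ≤ jT := hj.trans (min_le_left _ _)
  have hjH_ : j₀ ≤ jH := hj.trans (min_le_right _ _)
  -- the family and the three CLMs
  obtain ⟨PB, hPB⟩ := exists_block_clm_family (𝕜 := ℂ) (w := fun _ : Bond d (towerP L m (n + 1)) => c₀) (V := W)
    (fun x : Bond d (towerP L m (n + 1)) => blockCoord (L ^ (n + 1)) m (siteCast (towerP_eq_fineP_pow L m (n + 1)) (bpos x)))
  obtain ⟨Gtcl, hGtcl⟩ : ∃ T : BondL2K ℂ d (towerP L m (n + 1)) c₀ W →L[ℂ] BondL2K ℂ d (towerP L m (n + 1)) c₀ W,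
      T = LinearMap.toContinuousLinearMap (G1LatticeK hposπ) := ⟨_, rfl⟩
  obtain ⟨Qcl, hQcl⟩ : ∃ T : BondL2K ℂ d (towerP L m (n + 1)) c₀ W →L[ℂ] BondL2K ℂ d m c₁ W, T = LinearMap.toContinuousLinearMap (QkW L m n φ U hL αU hα1 hU1 hreg (c₀ := c₀) (c₁ := c₁)) := ⟨_, rfl⟩
  obtain ⟨Hcl, hHcl⟩ : ∃ T : BondL2K ℂ d m c₁ W →L[ℂ] BondL2K ℂ d (towerP L m (n + 1)) c₀ W, T = LinearMap.toContinuousLinearMap (H1LatticeK hposπ hQ) := ⟨_, rfl⟩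
  obtain ⟨Dcl, hDcl⟩ : ∃ T : BondL2K ℂ d (towerP L m (n + 1)) c₀ W →L[ℂ] BondL2K ℂ d (towerP L m (n + 1)) c₀ W,
      ∀ (u : BondL2K ℂ d (towerP L m (n + 1)) c₀ W) (b' : Bond d (towerP L m (n + 1))),
        WL2.equiv ℂ (fun _ : Bond d (towerP L m (n + 1)) => c₀) W (T u) b' =
          WL2.equiv ℂ (fun _ : Bond d (towerP L m (n + 1)) => c₀) W (covDerivL2K ℂ c₀ ((η : ℂ))⁻¹ (adTransportW φ U)
            ((WL2.equiv ℂ (fun _ : TSite d (towerP L m (n + 1)) => c₀) W).symm fun y =>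
              WL2.equiv ℂ (fun _ : Bond d (towerP L m (n + 1)) => c₀) W u (y, μ))) b' :=
    ⟨LinearMap.toContinuousLinearMap (covDerivL2K ℂ c₀ ((η : ℂ))⁻¹ (adTransportW φ U) ∘ₗ
        (WL2.linearEquiv ℂ ℂ (fun _ : TSite d (towerP L m (n + 1)) => c₀)).symm.toLinearMap ∘ₗ
        LinearMap.funLeft ℂ W (fun y : TSite d (towerP L m (n + 1)) => ((y, μ) : Bond d (towerP L m (n + 1)))) ∘ₗ
        (WL2.linearEquiv ℂ ℂ (fun _ : Bond d (towerP L m (n + 1)) => c₀)).toLinearMap), fun _ _ => rfl⟩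
  -- (L)(G̃_k; B_T, κ)
  have hG : ∀ (v : TSite d m) (f : BondL2K ℂ d (towerP L m (n + 1)) c₀ W) (F : ℝ),
      (∀ x, blockCoord (L ^ (n + 1)) m (siteCast (towerP_eq_fineP_pow L m (n + 1)) (bpos x)) ≠ v → WL2.equiv ℂ (fun _ : Bond d (towerP L m (n + 1)) => c₀) W f x = 0) →
      (∀ x, ‖WL2.equiv ℂ (fun _ : Bond d (towerP L m (n + 1)) => c₀) W f x‖ ≤ F) →
      ∀ x, ‖WL2.equiv ℂ (fun _ : Bond d (towerP L m (n + 1)) => c₀) W (Gtcl f) x‖ ≤ BT * Real.exp (-(κ * tdist m (blockCoord (L ^ (n + 1)) m (siteCast (towerP_eq_fineP_pow L m (n + 1)) (bpos x))) v)) * F := by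
    intro v f F hfv hfF x
    have hF : 0 ≤ F := (norm_nonneg _).trans (hfF x)
    rw [hGtcl, LinearMap.coe_toContinuousLinearMap']
    exact (HT n η hηL c₀ c₁ hw hρ m hm U αU hα0 hα1 hU1 hreg εU hεU hUε hLb α hα hαT_ hUst hUb hUη hpl hUgrad hRlev hεg hAQ hpos' hpos hc₀η j₀ hJ hjT_
      hposπ v f F hfv hfF x x.1).1.trans
      (mul_le_mul_of_nonneg_right (mul_le_mul_of_nonneg_left (exp_weaken' hκT (tdist_nonneg m _ _)) hBT) hF)
  -- (L)(∇_μ∘H̃_k; B_H′, κ)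
  have hH : ∀ (v : TSite d m) (z : BondL2K ℂ d m c₁ W) (F : ℝ), (∀ x, bpos x ≠ v → WL2.equiv ℂ (fun _ : Bond d m => c₁) W z x = 0) →
      (∀ x, ‖WL2.equiv ℂ (fun _ : Bond d m => c₁) W z x‖ ≤ F) →
      ∀ x, ‖WL2.equiv ℂ (fun _ : Bond d (towerP L m (n + 1)) => c₀) W ((Dcl ∘L Hcl) z) x‖ ≤ BH * Real.exp (-(κ * tdist m (blockCoord (L ^ (n + 1)) m (siteCast (towerP_eq_fineP_pow L m (n + 1)) (bpos x))) v)) * F := by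
    intro v z F hzv hzF x
    have hF : 0 ≤ F := (norm_nonneg _).trans (hzF b')
    rw [ContinuousLinearMap.comp_apply, hDcl, hHcl, LinearMap.coe_toContinuousLinearMap']
    exact (HH n η hηL c₀ c₁ hw hρ m hm U αU hα0 hα1 hαL hU1 hreg εU hεU hUε hLb α hα hαH_ hUst hUb hUη hpl hUgrad hRlev hεg hAQ hpos' hpos hc₀η j₀ hJ hjH_
      hposπ hQ v z F hzv hzF μ x).1.trans
      (mul_le_mul_of_nonneg_right (mul_le_mul_of_nonneg_left (exp_weaken' hκH (tdist_nonneg m _ _)) hBH) hF)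
  -- (L)(Q_k; C_Q·2√d·e^κ, κ): size from the block letter (height-free through the window), range `1`
  have hμB : ∀ u : TSite d m, ∑ x : Bond d (towerP L m (n + 1)), (if blockCoord (L ^ (n + 1)) m (siteCast (towerP_eq_fineP_pow L m (n + 1)) (bpos x)) = u then c₀ else 0) ≤ (d : ℝ) * c₁ := by
    intro u
    have h := sum_bondMass_bigBlock_le L m n hc₀.le u
    calc _ ≤ c₀ * (d * ((L : ℝ) ^ (n + 1)) ^ d) := h
      _ = (d : ℝ) * c₁ := by rw [← hw]; ring
  have hblk : ∀ (u : BondL2K ℂ d (towerP L m (n + 1)) c₀ W) (F : ℝ), 0 ≤ F →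
      (∀ x, ‖WL2.equiv ℂ (fun _ : Bond d (towerP L m (n + 1)) => c₀) W u x‖ ≤ F) → ∀ y : TSite d m, ‖PB y u‖ ≤ Real.sqrt ((d : ℝ) * c₁) * F := by
    intro u F hF huF y
    refine norm_le_sqrt_mass_mul (w := fun _ : Bond d (towerP L m (n + 1)) => c₀) (π := fun x : Bond d (towerP L m (n + 1)) => blockCoord (L ^ (n + 1)) m (siteCast (towerP_eq_fineP_pow L m (n + 1)) (bpos x)))
      y (hμB y) (PB y u) hF (fun x hx => ?_) (fun x => ?_)
    · rw [hPB, if_neg hx]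
    · rw [hPB]
      by_cases hx : blockCoord (L ^ (n + 1)) m (siteCast (towerP_eq_fineP_pow L m (n + 1)) (bpos x)) = y
      · rw [if_pos hx]; exact huF x
      · rw [if_neg hx, norm_zero]; exact hF
  have hsd2 : Real.sqrt ((d : ℝ) * c₁) = Real.sqrt d * Real.sqrt c₁ := Real.sqrt_mul (Nat.cast_nonneg d) c₁
  have hsc : 0 < Real.sqrt c₁ := Real.sqrt_pos.2 hc₁
  have hexpα : Real.exp (Real.sqrt ((L : ℝ) ^ d) * (Real.sqrt (2 * d) * (102 * (d + 1) ^ 2 * L)) * (α / (1 - ϱ))) ≤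
      Real.exp (Real.sqrt ((L : ℝ) ^ d) * (Real.sqrt (2 * d) * (102 * (d + 1) ^ 2 * L)) * (αs / (1 - ϱ))) :=
    Real.exp_le_exp.2 (mul_le_mul_of_nonneg_left (div_le_div_of_nonneg_right hαle h1ϱ.le) hW0)
  have hQM : ∀ (u : BondL2K ℂ d (towerP L m (n + 1)) c₀ W) (F : ℝ), (∀ x, ‖WL2.equiv ℂ (fun _ : Bond d (towerP L m (n + 1)) => c₀) W u x‖ ≤ F) →
      ∀ c, ‖WL2.equiv ℂ (fun _ : Bond d m => c₁) W (Qcl u) c‖ ≤ CQ * (2 * Real.sqrt d) * F := by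
    intro u F huF c
    have hF : 0 ≤ F := (norm_nonneg _).trans (huF (y₀, b'.2))
    have h := norm_equiv_QkW_apply_le_blocks L m n φ U hL αU hα1 hU1 hreg hMφ hφ hMφ' hφ' εU hεU hUε hϱ0 hϱ1 hα hεg hPB hw.symm u c
    have h1 := hblk u F hF huF c.1
    have h2 := hblk u F hF huF (shift c.2 c.1)
    rw [hQcl, LinearMap.coe_toContinuousLinearMap']
    refine h.trans ?_
    calc Mφ' * Mφ * Real.exp (Real.sqrt ((L : ℝ) ^ d) * (Real.sqrt (2 * d) * (102 * (d + 1) ^ 2 * L)) * (α / (1 - ϱ))) / Real.sqrt c₁ *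
          (‖PB c.1 u‖ + ‖PB (shift c.2 c.1) u‖)
        ≤ Mφ' * Mφ * Real.exp (Real.sqrt ((L : ℝ) ^ d) * (Real.sqrt (2 * d) * (102 * (d + 1) ^ 2 * L)) * (αs / (1 - ϱ))) / Real.sqrt c₁ *
          (Real.sqrt ((d : ℝ) * c₁) * F + Real.sqrt ((d : ℝ) * c₁) * F) := by
          refine mul_le_mul ?_ (add_le_add h1 h2) (add_nonneg (norm_nonneg _) (norm_nonneg _)) (div_nonneg (hCQ ▸ hCQ0) hsc.le)
          exact div_le_div_of_nonneg_right (mul_le_mul_of_nonneg_left hexpα (mul_nonneg hMφ' hMφ)) hsc.le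
      _ = CQ * (2 * Real.sqrt d) * F := by
          rw [hCQ, hsd2]
          field_simp
          ring
  have hQρ : ∀ (v : TSite d m) (u : BondL2K ℂ d (towerP L m (n + 1)) c₀ W),
      (∀ x, blockCoord (L ^ (n + 1)) m (siteCast (towerP_eq_fineP_pow L m (n + 1)) (bpos x)) ≠ v → WL2.equiv ℂ (fun _ : Bond d (towerP L m (n + 1)) => c₀) W u x = 0) →
      ∀ c : Bond d m, (1 : ℝ) < tdist m (bpos c) v → WL2.equiv ℂ (fun _ : Bond d m => c₁) W (Qcl u) c = 0 := by
    intro v u huv c hc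
    have h1 : c.1 ≠ v := by
      intro h1
      have : tdist m (bpos c) v = 0 := by rw [show bpos c = c.1 from rfl, h1, tdist_self]
      linarith only [this, hc]
    have h2 : shift c.2 c.1 ≠ v := by
      intro h2
      have : tdist m (bpos c) v ≤ 1 := by rw [show bpos c = c.1 from rfl, ← h2]; exact tdist_shift_le_one hm c.1 c.2
      linarith only [this, hc]
    rw [hQcl, LinearMap.coe_toContinuousLinearMap', equiv_QkW_apply,
      QkOfU_apply_eq_zero_of_support L m hL (n + 1) U αU hα1 hU1 hreg v _ (fun x hx => by rw [huv x hx, map_zero]) c h1 h2, map_zero]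
  have hQf := letter_of_range (tdist m) (fun x : Bond d (towerP L m (n + 1)) => blockCoord (L ^ (n + 1)) m (siteCast (towerP_eq_fineP_pow L m (n + 1)) (bpos x))) (fun c : Bond d m => bpos c) Qcl (M := CQ * (2 * Real.sqrt d))
    (ρ := 1) (κ := κ) hκ0.le hQM hQρ
  -- the two compositions, one rate loss
  have hS : ∀ w' : TSite d m, ∑ u : TSite d m, Real.exp (-((κ - κ / 2) * tdist m w' u)) ≤ K := fun w' => by
    rw [hKdef]; exact torusSum_le d hm (sub_pos.2 (half_lt_self hκ0)) w'
  have hMQf0 : 0 ≤ CQ * (2 * Real.sqrt d) * Real.exp (κ * 1) := mul_nonneg (mul_nonneg hCQ0 (mul_nonneg zero_le_two (Real.sqrt_nonneg _))) (Real.exp_nonneg _)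
  have h₁ := letter_comp (tdist m) (fun x : Bond d (towerP L m (n + 1)) => blockCoord (L ^ (n + 1)) m (siteCast (towerP_eq_fineP_pow L m (n + 1)) (bpos x))) (fun x : Bond d (towerP L m (n + 1)) => blockCoord (L ^ (n + 1)) m (siteCast (towerP_eq_fineP_pow L m (n + 1)) (bpos x)))
    (fun c : Bond d m => bpos c) Gtcl Qcl (tdist_nonneg m) (fun u y w' => tdist_triangle hm u y w') (B₁ := BT) (B₂ := CQ * (2 * Real.sqrt d) * Real.exp (κ * 1))
    (κ₁ := κ) (κ₂ := κ) (κ' := κ / 2) (S := K) hBT hMQf0 (half_pos hκ0).le (half_le_self hκ0.le) hG hQf hS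
  have h₂ := letter_comp (tdist m) (fun x : Bond d (towerP L m (n + 1)) => blockCoord (L ^ (n + 1)) m (siteCast (towerP_eq_fineP_pow L m (n + 1)) (bpos x))) (fun c : Bond d m => bpos c)
    (fun x : Bond d (towerP L m (n + 1)) => blockCoord (L ^ (n + 1)) m (siteCast (towerP_eq_fineP_pow L m (n + 1)) (bpos x))) (Qcl ∘L Gtcl) (Dcl ∘L Hcl) (tdist_nonneg m) (fun u y w' => tdist_triangle hm u y w')
    (B₁ := BT * (CQ * (2 * Real.sqrt d) * Real.exp (κ * 1)) * K) (B₂ := BH) (κ₁ := κ / 2) (κ₂ := κ) (κ' := κ / 2) (S := K)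
    (mul_nonneg (mul_nonneg hBT hMQf0) hK0) hBH (half_pos hκ0).le le_rfl h₁ hH hS v f F hfv hfF b
  have e : ((Dcl ∘L Hcl) ∘L (Qcl ∘L Gtcl)) f = Dcl (H1LatticeK hposπ hQ (QkW L m n φ U hL αU hα1 hU1 hreg (c₀ := c₀) (c₁ := c₁) (G1LatticeK hposπ f))) := by
    rw [hHcl, hQcl, hGtcl]; rfl
  rw [e, hDcl] at h₂
  have h₂' : ‖WL2.equiv ℂ (fun _ : Bond d (towerP L m (n + 1)) => c₀) W (covDerivL2K ℂ c₀ ((η : ℂ))⁻¹ (adTransportW φ U)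
      ((WL2.equiv ℂ (fun _ : TSite d (towerP L m (n + 1)) => c₀) W).symm fun y =>
        WL2.equiv ℂ (fun _ : Bond d (towerP L m (n + 1)) => c₀) W
          (H1LatticeK hposπ hQ (QkW L m n φ U hL αU hα1 hU1 hreg (c₀ := c₀) (c₁ := c₁) (G1LatticeK hposπ f))) (y, μ))) b‖ ≤
      Bs * Real.exp (-(κ / 2 * tdist m (blockCoord (L ^ (n + 1)) m (siteCast (towerP_eq_fineP_pow L m (n + 1)) (bpos b))) v)) * F := by
    refine h₂.trans (le_of_eq ?_)
    rw [hBs]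
  exact ⟨h₂', norm_covGrad_apply_le_of_slice _ _ _ b μ h₂'⟩

end Literature.MathematicalPhysics.QuantumFieldTheory.Balaban1983to89.B9Eq3147MiddleWordPiSliceGradRowClosed

end
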